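import Summits.BirchSwinnertonDyer.Rank1Residual.X11a.ChainLargePrime
import Summits.BirchSwinnertonDyer.Rank1Residual.X11a.ChainNotDvd
import Literature.NumberTheory.EllipticCurves.CyclotomicPAdicLFunctionWeightKProofs
import HarnessLib

/-!
# Class X11a, surjective leaf (`p ≥ 5`) and all of X11a at `p ≥ 11`: the chain of record with the
# Mazur–Tate–Teitelbaum existence fact DISCHARGED (cell `b2b-bsdres`, unit `b2b-bsdres-x11a`, gen 16)

HONEST FRAMING (run/shared/lean/b2b/bsd-rank1-residual/, verbatim in every file): the goal of the
cell is to DELETE the COMBINATION-SHAPED residual classes of the Birch–Swinnerton-Dyer formula for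
ALL analytic-rank `≤ 1` elliptic curves over `ℚ` — "full BSD formula for every rank `≤ 1` curve in
class `C`" assembled STRICTLY from published theorems — so that the rank-`≤ 1` remainder becomes
exactly the CONSTRUCTION-SHAPED classes, which are TYPED (missing-input `Prop`s), NOT attempted.
This is not "finishing BSD". Research route; NO CLAIM BEYOND STATED CLASSES.

`X11a/ChainNamedFacts.lean` (`forall_bsdp_of_namedFacts`, p206662) proves `BSD(E,p)` on X11a ∩
{`p ≥ 5`, `ρ̄_{E,p}` surjective} from 17 named published facts + the per-pair certificate
`μ^an(E,p) = 0`; `X11a/ChainLargePrime.lean` (x11c, p209022) discharges the `Surj` binder at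
`p ≥ 11`.  One of the 17 binders, `hMTT : exists_isCycPAdicLFunctionWeightK` (Mazur–Tate–Teitelbaum
1986, §I.10–I.14: existence of the cyclotomic `p`-adic `L`-function of an ordinary newform of weight
`k ≥ 2` with `ℚ̄_p` coefficients; CITED-FACTS A78), is now a THEOREM of the tree —
`exists_isCycPAdicLFunctionWeightK_holds` (`CyclotomicPAdicLFunctionWeightKProofs.lean`, x11a gen 16:
the datum distribution, bounded denominators by a Noetherian argument from Manin's theorems,
coordinates over `ℚ_p` into the tree's `ℚ_p` Mellin-transform engine).  This file records the two
chain theorems with that binder removed (16 named facts + certificate; 17 with BDMTV at `p ≥ 11` and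
no image hypothesis).  No label change by this file (cell lead / referee).

References: [MazurTateTeitelbaum1986Invent] §I.10–I.14; the chain's sources as cited in
`X11a/ChainNamedFacts.lean` and `X11a/ChainLargePrime.lean`.
-/

noncomputable section

open scoped Classical

open WeierstrassCurve Literature.NumberTheory.EllipticCurves
  Literature.NumberTheory.EllipticCurves.ModularForms
  Literature.NumberTheory.EllipticCurves.Rank1Residual
  Literature.NumberTheory.EllipticCurves.Rank1Residual.Typed
  Literature.NumberTheory.EllipticCurves.Wuthrich2014
  Literature.NumberTheory.EllipticCurves.SteinWuthrich2013
  Literature.NumberTheory.EllipticCurves.GreenbergVatsal2000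
  Literature.NumberTheory.EllipticCurves.EmertonPollackWeston2006
  Literature.NumberTheory.EllipticCurves.BalakrishnanEtAl2019
  Summit.BirchSwinnertonDyer.Rank1Residual.X1.MuLambda
  Summit.BirchSwinnertonDyer.Rank1Residual.X11a.LambdaNorm

set_option autoImplicit false

namespace Summit.BirchSwinnertonDyer.Rank1Residual.X11a

open Chain

/-- **X11a ∩ {`p ≥ 5`, `ρ̄_{E,p}` surjective}: `BSD(E,p)` ⇐ 16 NAMED PUBLISHED FACTS + the
per-pair certificate `μ^an(E,p) = 0`** — `forall_bsdp_of_namedFacts` with its Mazur–Tate–Teitelbaum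
binder `hMTT` supplied by the tree theorem `exists_isCycPAdicLFunctionWeightK_holds`.
[cite: MazurTateTeitelbaum1986Invent, §I.11 and §I.14 (14.3)]
[cite: EmertonPollackWeston2006, Thm. 1, Thm. 3.1.1, Thm. 5.1.3, §3.1] [cite: Wan2015, Thm. 4]
[cite: SteinWuthrich2013, Thm. 6.1 (p. 20)] [cite: Wuthrich2014, Thm. 3 (p. 382) and Cor. 19 proof (p. 399)] -/
theorem forall_bsdp_of_namedFacts_mtt
    (hHida : hida_exists_congruent_ordinary_newform_of_multiplicative)
    (h311 : thm311_cotorsion_weightK_member) (hT1a : thm1_muAlg_of_weightK_member)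
    (hT2 : Wan2015.thm4_rational_weightK_member) (hT1b : thm513_transfer_from_weightK_member)
    (h61 : DeligneSerre1974.thm61_exists_adicGaloisRep) (h326 : Hida2000_thm326_ordinary)
    (hKato : kato_charIdeal_dvd_multiplicative_of_surjective)
    (hJs : thm61_splitMultiplicative) (hJn : thm61_nonsplitMultiplicative)
    (hHs : exists_isSplitMultCanonical) (hHn : exists_isMultCanonical)
    (hGZK : rank_eq_analyticRank_of_analyticRank_le_one) (hmod : hasEntireLFunction_rat)
    (hpar : nonempty_modularParametrizationData)
    (hGS : ∀ (W : WeierstrassCurve ℚ) [W.IsElliptic] [W.IsGloballyMinimal] (p : ℕ) [Fact p.Prime],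
      greenberg_stevens (W := W) (p := p)) :
    ∀ (W : WeierstrassCurve ℚ) [W.IsElliptic] [W.IsGloballyMinimal] (p : ℕ) [Fact p.Prime],
      ClassX11a W p → 5 ≤ p → Surj W p → MuAnZeroAt W p → BSDp W p :=
  forall_bsdp_of_namedFacts hHida exists_isCycPAdicLFunctionWeightK_holds h311 hT1a hT2 hT1b h61 h326
    hKato hJs hJn hHs hHn hGZK hmod hpar hGS

/-- **X11a ∩ {`p ≥ 11`}: `BSD(E,p)` ⇐ 17 NAMED PUBLISHED FACTS + the per-pair certificate, with NO
hypothesis on the image of `ρ̄_{E,p}`** — x11c's `forall_bsdp_of_namedFacts_of_eleven_le` with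
`hMTT` supplied by `exists_isCycPAdicLFunctionWeightK_holds`.
[cite: MazurTateTeitelbaum1986Invent, §I.11 and §I.14 (14.3)]
[cite: BalakrishnanEtAl2019, §1 Thm. 1.2 (arXiv:1711.05846 p. 2)] -/
theorem forall_bsdp_of_namedFacts_mtt_of_eleven_le
    (hHida : hida_exists_congruent_ordinary_newform_of_multiplicative)
    (h311 : thm311_cotorsion_weightK_member) (hT1a : thm1_muAlg_of_weightK_member)
    (hT2 : Wan2015.thm4_rational_weightK_member) (hT1b : thm513_transfer_from_weightK_member)
    (h61 : DeligneSerre1974.thm61_exists_adicGaloisRep) (h326 : Hida2000_thm326_ordinary)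
    (hKato : kato_charIdeal_dvd_multiplicative_of_surjective)
    (hJs : thm61_splitMultiplicative) (hJn : thm61_nonsplitMultiplicative)
    (hHs : exists_isSplitMultCanonical) (hHn : exists_isMultCanonical)
    (hGZK : rank_eq_analyticRank_of_analyticRank_le_one) (hmod : hasEntireLFunction_rat)
    (hpar : nonempty_modularParametrizationData)
    (hGS : ∀ (W : WeierstrassCurve ℚ) [W.IsElliptic] [W.IsGloballyMinimal] (p : ℕ) [Fact p.Prime],
      greenberg_stevens (W := W) (p := p))
    (hB : thm12_not_le_normalizer_splitCartan) :
    ∀ (W : WeierstrassCurve ℚ) [W.IsElliptic] [W.IsGloballyMinimal] (p : ℕ) [Fact p.Prime],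
      ClassX11a W p → 11 ≤ p → MuAnZeroAt W p → BSDp W p :=
  forall_bsdp_of_namedFacts_of_eleven_le hHida exists_isCycPAdicLFunctionWeightK_holds h311 hT1a hT2
    hT1b h61 h326 hKato hJs hJn hHs hHn hGZK hmod hpar hGS hB

/-- **X11a ∩ {`p ≥ 5`, `p ∤ ord_p(Δ_min)`}: `BSD(E,p)` ⇐ 16 NAMED PUBLISHED FACTS + the per-pair
certificate, with NO hypothesis on the image of `ρ̄_{E,p}` and no extra named fact** — x11c's
`forall_bsdp_of_namedFacts_of_not_dvd` (`Surj` from the integer check `p ∤ ord_p Δ_min`, Serre 1972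
§1.12 / §2.4, tree theorems) with `hMTT` supplied by `exists_isCycPAdicLFunctionWeightK_holds`.
[cite: MazurTateTeitelbaum1986Invent, §I.11 and §I.14 (14.3)]
[cite: SerreInventiones1972, §1.12 (Cor. of Prop. 13), §2.4 Prop. 15] -/
theorem forall_bsdp_of_namedFacts_mtt_of_not_dvd
    (hHida : hida_exists_congruent_ordinary_newform_of_multiplicative)
    (h311 : thm311_cotorsion_weightK_member) (hT1a : thm1_muAlg_of_weightK_member)
    (hT2 : Wan2015.thm4_rational_weightK_member) (hT1b : thm513_transfer_from_weightK_member)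
    (h61 : DeligneSerre1974.thm61_exists_adicGaloisRep) (h326 : Hida2000_thm326_ordinary)
    (hKato : kato_charIdeal_dvd_multiplicative_of_surjective)
    (hJs : thm61_splitMultiplicative) (hJn : thm61_nonsplitMultiplicative)
    (hHs : exists_isSplitMultCanonical) (hHn : exists_isMultCanonical)
    (hGZK : rank_eq_analyticRank_of_analyticRank_le_one) (hmod : hasEntireLFunction_rat)
    (hpar : nonempty_modularParametrizationData)
    (hGS : ∀ (W : WeierstrassCurve ℚ) [W.IsElliptic] [W.IsGloballyMinimal] (p : ℕ) [Fact p.Prime],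
      greenberg_stevens (W := W) (p := p)) :
    ∀ (W : WeierstrassCurve ℚ) [W.IsElliptic] [W.IsGloballyMinimal] (p : ℕ) [Fact p.Prime],
      ClassX11a W p → 5 ≤ p → ¬ p ∣ padicValInt p W.minimalDiscriminantInt →
        MuAnZeroAt W p → BSDp W p :=
  forall_bsdp_of_namedFacts_of_not_dvd hHida exists_isCycPAdicLFunctionWeightK_holds h311 hT1a hT2
    hT1b h61 h326 hKato hJs hJn hHs hHn hGZK hmod hpar hGS

end Summit.BirchSwinnertonDyer.Rank1Residual.X11a

end
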